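import Summits.Schanuel.Schanuel.Theorems.RootDecomp1KGeneric17

/-!
# RootDecomp1K — lens 6, generation 14: the LOG-SQUARE CARVING (LogSq.lean v3 efa85398…) — continuation (RootDecomp1KGeneric18): §3: the hypothesis-free extraction engine `logSqPairApprox_of_dependent_gen` at log-square quality, real instance, flagship `algebraicIndependent_exp_of_logSqLiouville`

(lens-6 g14 `LogSq.lean` v3, sha256 efa85398…, 1497 l, farm rc 0 · 0 warn · 0 sorry; port by census-1 gen 12 in five parts
RootDecomp1KGeneric17–21 at the section cuts named in CENSUS-REQUEST 2026-08-30T23:30:45Z; each part imports the previous;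
everything mod the cited fact `NesterenkoWaldschmidt1996_thm_1` where marked, otherwise hypothesis-free; `--supports stmt-Schanuel-31077`.)
-/

set_option linter.unusedSectionVars false

noncomputable section

open Complex Polynomial

namespace Summit.Schanuel.Schanuel.Theorems.RootDecomp1KGeneric

open Summit.Schanuel.Schanuel.Theorems.RootDecomp1KHyper
open Summit.Schanuel.Schanuel.Theorems.RootDecomp1KHyper.HyperCell
open Literature.NumberTheory.Transcendental (NesterenkoWaldschmidt1996_thm_1 weilHeight₁)

variable {K : ℕ}

/-- `1 ≤ log x` for `x ≥ 3`. -/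
private theorem one_le_log_of_three_le {x : ℝ} (hx : 3 ≤ x) : 1 ≤ Real.log x := by
  rw [Real.le_log_iff_exp_le (by linarith)]
  have := Real.exp_one_lt_d9
  linarith

/-! ## §3  P2: Liouville extraction in the exponent at log-square quality; the flagship -/

/-- The linear integer polynomial `q·X − p` of a rational `r = p/q` is irreducible. -/
private theorem irreducible_den_mul_X_sub_num' (r : ℚ) :
    Irreducible (C (r.den : ℤ) * X + C (-r.num) : ℤ[X]) := by
  have hden : (r.den : ℤ) ≠ 0 := by exact_mod_cast r.den_ne_zero
  have hdeg : (C (r.den : ℤ) * X + C (-r.num) : ℤ[X]).degree = 1 := by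
    rw [degree_add_eq_left_of_degree_lt] <;> rw [degree_C_mul_X hden]
    exact degree_C_le.trans_lt (by norm_num)
  have hprim : (C (r.den : ℤ) * X + C (-r.num) : ℤ[X]).IsPrimitive := by
    intro c hc
    rw [C_dvd_iff_dvd_coeff] at hc
    have h1 : c ∣ (r.den : ℤ) := by
      have := hc 1
      rwa [coeff_add, coeff_C_mul, coeff_X_one, mul_one, coeff_C, if_neg one_ne_zero,
        add_zero] at this
    have h0 : c ∣ r.num := by
      have := hc 0
      rwa [coeff_add, coeff_C_mul, coeff_X_zero, mul_zero, zero_add, coeff_C_zero, dvd_neg] at this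
    obtain ⟨u, v, huv⟩ := Rat.isCoprime_num_den r
    exact isUnit_of_dvd_one
      (huv ▸ dvd_add (dvd_mul_of_dvd_right h0 u) (dvd_mul_of_dvd_right h1 v))
  rw [hprim.irreducible_iff_irreducible_map_fraction_map (K := ℚ)]
  apply irreducible_of_degree_eq_one
  rwa [degree_map_eq_of_injective (algebraMap ℤ ℚ).injective_int]

/-- `q·X − p` has degree `1`, root `r`, and Mahler measure `max(|p|, q)`. -/
private theorem linear_poly_facts (r : ℚ) :
    (C (r.den : ℤ) * X + C (-r.num) : ℤ[X]).natDegree = 1 ∧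
      aeval ((r : ℝ) : ℂ) (C (r.den : ℤ) * X + C (-r.num) : ℤ[X]) = 0 ∧
      ((C (r.den : ℤ) * X + C (-r.num) : ℤ[X]).map (Int.castRingHom ℂ)).mahlerMeasure =
        max (|(r.num : ℝ)|) (r.den : ℝ) := by
  have hden : (r.den : ℤ) ≠ 0 := by exact_mod_cast r.den_ne_zero
  refine ⟨by rw [natDegree_add_C, natDegree_C_mul_X _ hden], ?_, ?_⟩
  · rw [Complex.ofReal_ratCast, map_add, map_mul, aeval_X, aeval_C, aeval_C, algebraMap_int_eq,
      eq_intCast, eq_intCast, Int.cast_neg, Int.cast_natCast]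
    have : (r : ℂ) * (r.den : ℂ) = (r.num : ℂ) := by exact_mod_cast Rat.mul_den_eq_num r
    linear_combination this
  · have hmap : (C (r.den : ℤ) * X + C (-r.num) : ℤ[X]).map (Int.castRingHom ℂ) =
        C (r.den : ℂ) * X + C (-(r.num : ℂ)) := by
      simp [Polynomial.map_add, Polynomial.map_mul]
    rw [hmap, mahlerMeasure_C_mul_X_add_C (by exact_mod_cast r.den_ne_zero), norm_neg,
      Complex.norm_natCast, Complex.norm_intCast, max_comm]

/-- The Mahler measure of a non-zero integer polynomial (over `ℂ`) is at least `1`. -/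
private theorem one_le_mahlerMeasure_int {R : ℤ[X]} (hR : R ≠ 0) :
    1 ≤ (R.map (Int.castRingHom ℂ)).mahlerMeasure := by
  refine one_le_mahlerMeasure_of_one_le_norm_leadingCoeff ?_
  rw [Polynomial.leadingCoeff_map_of_injective (RingHom.injective_int _), eq_intCast,
    Complex.norm_intCast]
  exact_mod_cast Int.one_le_abs (Polynomial.leadingCoeff_ne_zero.mpr hR)

/-- Mahler measure of the specialised relation: `M(specY G D p q) ≤ (K + 1) · relLen G · (|p| + q)^D`. -/
theorem mahlerMeasure_specY_le (G : Fin (K + 1) → ℤ[X]) {D : ℕ} (hD : ∀ k, (G k).natDegree ≤ D)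
    (p : ℤ) (q : ℕ) (hdeg : (specY G D p q).natDegree ≤ K) :
    ((specY G D p q).map (Int.castRingHom ℂ)).mahlerMeasure ≤
      ((K : ℝ) + 1) * (relLen G * ((|p| : ℝ) + q) ^ D) := by
  refine (mahlerMeasure_le_sum_norm_coeff _).trans ?_
  have hlt : ((specY G D p q).map (Int.castRingHom ℂ)).natDegree < K + 1 := by
    rw [natDegree_map_eq_of_injective (RingHom.injective_int _)]; omega
  rw [sum_over_range' _ (fun _ => norm_zero) (K + 1) hlt]
  calc ∑ j ∈ Finset.range (K + 1), ‖((specY G D p q).map (Int.castRingHom ℂ)).coeff j‖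
      ≤ ∑ _j ∈ Finset.range (K + 1), relLen G * ((|p| : ℝ) + q) ^ D :=
        Finset.sum_le_sum fun j _ => by
          rw [coeff_map, eq_intCast, Complex.norm_intCast]
          exact abs_coeff_specY_le G hD p q j
    _ = ((K : ℝ) + 1) * (relLen G * ((|p| : ℝ) + q) ^ D) := by
        rw [Finset.sum_const, Finset.card_range, nsmul_eq_mul]; push_cast; ring

set_option maxHeartbeats 800000 in
/-- **P2, engine (Liouville extraction in the exponent, log-square quality; hypothesis-free).**  Let
`ℓ` be log-square Liouville, `w = e^u`, and `ℓ, w` algebraically DEPENDENT; suppose `u` is approached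
by algebraic points `β_r` of degree `≤ d_β` and size `log M ≤ C_β log(|p| + q)` at the SAME distance
as `ℓ` by the rationals `r = p/q` (`‖u − β_r‖ = |ℓ − r|`; instances: `u = ℓ, β_r = r`; the imaginary
twin `u = iℓ, β_r = i r`; the off-axis rational points `u = ℓ + i s` / `s + iℓ`, `β_r = r + i s` /
`s + i r`, `s ∈ ℚ` fixed).  Then `(u, e^u)` admits log-square simultaneous approximations:
specialise an integer relation `Σ_k G_k(ℓ) w^k = 0` at `ℓ ≈ p/q` (`|ℓ − p/q| < q^{−i log q}`) and take
`α` = the root of `A_q = Σ_k q^D G_k(p/q) Y^k` nearest `w` (`root_package`): degree `≤ K·d_β`,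
`log M ≤ c log q`, distance `< exp(−m (log q)²)`. -/
theorem logSqPairApprox_of_dependent_gen {ℓ : ℝ} (hℓ : LogSqLiouville ℓ) {u w : ℂ}
    (hwu : cexp u = w) (hdep : ¬ AlgebraicIndependent ℚ ![(ℓ : ℂ), w]) {dβ : ℕ} (βof : ℚ → ℂ)
    (Cβ : ℝ) (hCβ : 0 ≤ Cβ)
    (hβ : ∀ r : ℚ, r ≠ 0 → ∃ f : ℤ[X], Irreducible f ∧ 0 < f.natDegree ∧ f.natDegree ≤ dβ ∧
      aeval (βof r) f = 0 ∧ βof r ≠ 0 ∧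
      Real.log ((f.map (Int.castRingHom ℂ)).mahlerMeasure) ≤ Cβ * Real.log ((|r.num| : ℝ) + r.den))
    (hdist : ∀ r : ℚ, ‖u - βof r‖ = |ℓ - r|) :
    LogSqPairApprox u := by
  classical
  have hℓt : Transcendental ℚ (ℓ : ℂ) := transcendental_ofReal_of_liouville hℓ.liouville
  obtain ⟨K, G, hGK, hrel⟩ := exists_int_relation hℓt hdep
  have hK : 0 < K := relation_degree_pos hℓt hGK hrel
  have hw0 : 0 < ‖w‖ := by rw [← hwu]; exact norm_pos_iff.mpr (Complex.exp_ne_zero _)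
  set D : ℕ := Finset.univ.sup fun k => (G k).natDegree with hDdef
  have hD : ∀ k, (G k).natDegree ≤ D := fun k =>
    Finset.le_sup (f := fun k => (G k).natDegree) (Finset.mem_univ k)
  obtain ⟨Λ, hΛ1, hΛ⟩ := exists_lipschitz_at (sliceAt G w) (ℓ : ℂ)
  have hRL1 : 1 ≤ relLen G := one_le_relLen G hGK
  -- the output constants
  set A : ℝ := Real.log (|ℓ| + 2) + 1 with hA
  have hA2 : 0 ≤ Real.log (|ℓ| + 2) := Real.log_nonneg (by linarith [abs_nonneg ℓ])
  have hA1 : 1 ≤ A := by linarith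
  set c : ℝ := Real.log ((K : ℝ) + 1) + Real.log (relLen G) + ((D : ℝ) + 1) * A + Cβ * A with hc
  have hlK0 : 0 ≤ Real.log ((K : ℝ) + 1) := Real.log_nonneg (by linarith [(Nat.cast_nonneg K : (0:ℝ) ≤ K)])
  have hlR0 : 0 ≤ Real.log (relLen G) := Real.log_nonneg hRL1
  have hAc : Cβ * A ≤ c := by
    have : 0 ≤ ((D : ℝ) + 1) * A := by positivity
    linarith
  refine ⟨K * dβ, c, fun m => ?_⟩
  -- the approximation scale (all thresholds folded into one index `i`)
  obtain ⟨KM, hKM⟩ : ∃ KM : ℕ, KM = K * (m + 1) := ⟨_, rfl⟩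
  obtain ⟨PK, hPK⟩ : ∃ PK : ℕ, PK = 2 ^ K := ⟨_, rfl⟩
  obtain ⟨i, hi1, hi2, hiB, hiΛ, hiP, hiw, him, hi3⟩ : ∃ i : ℕ, KM + D + 2 ≤ i ∧ m + 1 + 1 ≤ i ∧
      denBound (G (Fin.last K)) ≤ i ∧ ⌈Λ⌉₊ ≤ i ∧ PK ≤ i ∧ ⌈1 / ‖w‖⌉₊ + 1 ≤ i ∧ m ≤ i ∧ 3 ≤ i :=
    ⟨KM + D + 2 + (m + 2) + denBound (G (Fin.last K)) + ⌈Λ⌉₊ + PK + (⌈1 / ‖w‖⌉₊ + 1) + 3,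
      by omega, by omega, by omega, by omega, by omega, by omega, by omega, by omega⟩
  obtain ⟨r, hden, hne, hlt⟩ := hℓ i
  set q : ℕ := r.den with hq
  set p : ℤ := r.num with hp
  have hqi : i ≤ q := hden
  have hq3 : 3 ≤ q := le_trans hi3 hqi
  have hq3r : (3 : ℝ) ≤ q := by exact_mod_cast hq3
  have hq0r : (0 : ℝ) < q := by linarith
  have hq1r : (1 : ℝ) ≤ q := by linarith
  set L : ℝ := Real.log q with hL
  have hL1 : 1 ≤ L := one_le_log_of_three_le hq3r
  have hL0 : 0 ≤ L := by linarith
  have hLL : L ≤ L ^ 2 := by nlinarith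
  have hexpL : Real.exp L = q := by rw [hL, Real.exp_log hq0r]
  -- thresholds
  have hmq : m ≤ q := le_trans him hqi
  have hdenB : denBound (G (Fin.last K)) ≤ r.den := le_trans hiB hqi
  have hΛq : Λ ≤ q := (Nat.le_ceil Λ).trans (by exact_mod_cast (le_trans hiΛ hqi : ⌈Λ⌉₊ ≤ q))
  have h2Kq : (2 : ℝ) ^ K ≤ q := by
    have : 2 ^ K ≤ q := hPK ▸ le_trans hiP hqi
    exact_mod_cast this
  have hwq : 1 / ‖w‖ < q := by
    have h1 : (⌈1 / ‖w‖⌉₊ : ℝ) + 1 ≤ q := by exact_mod_cast (le_trans hiw hqi : ⌈1 / ‖w‖⌉₊ + 1 ≤ q)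
    linarith [Nat.le_ceil (1 / ‖w‖)]
  have hqw : 1 / (q : ℝ) < ‖w‖ := by
    rw [div_lt_iff₀ hq0r]; rw [div_lt_iff₀ hw0] at hwq; linarith
  -- `|ℓ − r| < exp(−i L²) ≤ 1`
  have hη : |ℓ - r| < Real.exp (-((i : ℝ) * L ^ 2)) := hlt
  have hη1 : |ℓ - r| ≤ 1 := by
    refine hη.le.trans ?_
    rw [Real.exp_le_one_iff]
    have : (0 : ℝ) ≤ (i : ℝ) * L ^ 2 := by positivity
    linarith
  -- the root package at `r`
  obtain ⟨hS0, hSdeg, y, hy, hpow⟩ := root_package G hK hGK hD hrel hΛ r hdenB hη1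
  -- size of `p`
  have hr0 : r ≠ 0 := by
    rintro rfl
    simp [hq] at hq3
  have hrq : (r : ℝ) = (p : ℝ) / q := by rw [hp, hq]; exact Rat.cast_def r
  have habsr : |(r : ℝ)| ≤ |ℓ| + 1 := by
    have := abs_sub_abs_le_abs_sub (r : ℝ) ℓ
    rw [abs_sub_comm] at this
    linarith
  have habsp : |(p : ℝ)| ≤ (|ℓ| + 1) * q := by
    have h1 : (p : ℝ) = (r : ℝ) * q := by rw [hrq]; field_simp
    rw [h1, abs_mul, Nat.abs_cast]
    exact mul_le_mul_of_nonneg_right habsr hq0r.le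
  have hpq : (|p| : ℝ) + q ≤ (|ℓ| + 2) * q := by nlinarith
  have hpq0 : (0 : ℝ) < (|p| : ℝ) + q := by
    have : (0 : ℝ) ≤ |(p : ℝ)| := abs_nonneg _
    linarith
  have hlogpq : Real.log ((|p| : ℝ) + q) ≤ Real.log (|ℓ| + 2) + L := by
    calc Real.log ((|p| : ℝ) + q) ≤ Real.log ((|ℓ| + 2) * q) := Real.log_le_log hpq0 hpq
      _ = Real.log (|ℓ| + 2) + L := by
          rw [Real.log_mul (by linarith [abs_nonneg ℓ]) hq0r.ne', hL]
  have hlogpq' : Real.log ((|p| : ℝ) + q) ≤ A * L := by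
    calc Real.log ((|p| : ℝ) + q) ≤ Real.log (|ℓ| + 2) + L := hlogpq
      _ ≤ Real.log (|ℓ| + 2) * L + L := by nlinarith
      _ = A * L := by rw [hA]; ring
  -- the budget: `q^D · Λ · exp(−i L²) · 2^K ≤ exp(−K(m+1) L²)`
  set ε : ℝ := Real.exp (-(((m : ℝ) + 1) * L ^ 2)) with hε
  have hε0 : 0 < ε := Real.exp_pos _
  have hqD : (q : ℝ) ^ D ≤ Real.exp ((D : ℝ) * L ^ 2) := by
    calc (q : ℝ) ^ D = Real.exp ((D : ℝ) * L) := by rw [Real.exp_nat_mul, hexpL]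
      _ ≤ Real.exp ((D : ℝ) * L ^ 2) :=
          Real.exp_le_exp.mpr (mul_le_mul_of_nonneg_left hLL (Nat.cast_nonneg D))
  have hΛe : Λ ≤ Real.exp (L ^ 2) :=
    hΛq.trans (by rw [← hexpL]; exact Real.exp_le_exp.mpr hLL)
  have h2Ke : (2 : ℝ) ^ K ≤ Real.exp (L ^ 2) :=
    h2Kq.trans (by rw [← hexpL]; exact Real.exp_le_exp.mpr hLL)
  have hΛ0 : 0 ≤ Λ := by linarith
  have hiK : ((K : ℝ) * (m + 1) + D + 2) ≤ (i : ℝ) := by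
    have : K * (m + 1) + D + 2 ≤ i := hKM ▸ hi1
    exact_mod_cast this
  have hexpi : Real.exp (-((i : ℝ) * L ^ 2)) ≤ Real.exp (-(((K : ℝ) * (m + 1) + D + 2) * L ^ 2)) := by
    rw [Real.exp_le_exp, neg_le_neg_iff]
    exact mul_le_mul_of_nonneg_right hiK (by positivity)
  have hbudget : (q : ℝ) ^ D * Λ * Real.exp (-((i : ℝ) * L ^ 2)) * (2 : ℝ) ^ K ≤
      Real.exp (-((K : ℝ) * (((m : ℝ) + 1) * L ^ 2))) := by
    calc (q : ℝ) ^ D * Λ * Real.exp (-((i : ℝ) * L ^ 2)) * (2 : ℝ) ^ K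
        ≤ Real.exp ((D : ℝ) * L ^ 2) * Real.exp (L ^ 2) *
            Real.exp (-(((K : ℝ) * (m + 1) + D + 2) * L ^ 2)) * Real.exp (L ^ 2) := by
          gcongr
      _ = Real.exp (-((K : ℝ) * (((m : ℝ) + 1) * L ^ 2))) := by
          rw [← Real.exp_add, ← Real.exp_add, ← Real.exp_add]; congr 1; ring
  have hεK : Real.exp (-((K : ℝ) * (((m : ℝ) + 1) * L ^ 2))) = ε ^ K := by
    rw [hε, ← Real.exp_nat_mul]; congr 1; ring
  -- `‖w − y‖ < ε / 2`
  have hpowlt : ‖w - y‖ ^ K < (ε / 2) ^ K := by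
    have h1 : (q : ℝ) ^ D * Λ * |ℓ - r| ≤ (q : ℝ) ^ D * Λ * Real.exp (-((i : ℝ) * L ^ 2)) :=
      mul_le_mul_of_nonneg_left hη.le (by positivity)
    have h2 : (q : ℝ) ^ D * Λ * Real.exp (-((i : ℝ) * L ^ 2)) ≤ ε ^ K / (2 : ℝ) ^ K := by
      rw [le_div_iff₀ (by positivity), ← hεK]; exact hbudget
    have h3 : ε ^ K / (2 : ℝ) ^ K = (ε / 2) ^ K := by rw [div_pow]
    have h4 : ‖w - y‖ ^ K ≤ (ε / 2) ^ K := by rw [← h3]; exact hpow.trans (h1.trans h2)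
    rcases h4.lt_or_eq with h5 | h5
    · exact h5
    · -- equality would force `|ℓ − r| = exp(−iL²)`-tightness; exclude via the strict `hη`
      exfalso
      have h6 : (q : ℝ) ^ D * Λ * |ℓ - r| < (q : ℝ) ^ D * Λ * Real.exp (-((i : ℝ) * L ^ 2)) := by
        refine mul_lt_mul_of_pos_left hη ?_
        have hq1D : (1 : ℝ) ≤ (q : ℝ) ^ D := one_le_pow₀ hq1r
        positivity
      have : ‖w - y‖ ^ K < (ε / 2) ^ K := by
        rw [← h3]; exact lt_of_le_of_lt hpow (h6.trans_le h2)
      exact absurd h5 this.ne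
  have hwy : ‖w - y‖ < ε / 2 := lt_of_pow_lt_pow_left₀ K (by positivity) hpowlt
  -- `|ℓ − r| < ε / 2`
  have hℓr : |ℓ - r| < ε / 2 := by
    refine hη.trans_le ?_
    have h2e : (2 : ℝ) ≤ Real.exp (((i : ℝ) - (m + 1)) * L ^ 2) := by
      have h1 : (1 : ℝ) ≤ ((i : ℝ) - (m + 1)) * L ^ 2 := by
        have him : (1 : ℝ) ≤ (i : ℝ) - (m + 1) := by
          have h0 : ((m + 1 + 1 : ℕ) : ℝ) ≤ i := by exact_mod_cast hi2
          push_cast at h0; linarith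
        have hL2 : (1 : ℝ) ≤ L ^ 2 := by nlinarith
        exact one_le_mul_of_one_le_of_one_le him hL2
      linarith [Real.add_one_le_exp (((i : ℝ) - (m + 1)) * L ^ 2)]
    rw [hε, le_div_iff₀ (by norm_num : (0 : ℝ) < 2)]
    calc Real.exp (-((i : ℝ) * L ^ 2)) * 2 ≤ Real.exp (-((i : ℝ) * L ^ 2)) *
          Real.exp (((i : ℝ) - (m + 1)) * L ^ 2) := mul_le_mul_of_nonneg_left h2e (Real.exp_pos _).le
      _ = Real.exp (-(((m : ℝ) + 1) * L ^ 2)) := by rw [← Real.exp_add]; congr 1; ring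
  -- `ε ≤ 1/q < ‖w‖`, so `y ≠ 0`
  have hεq : ε ≤ 1 / q := by
    have h1 : ε ≤ Real.exp (-L) := by
      rw [hε, Real.exp_le_exp, neg_le_neg_iff]
      have : (0 : ℝ) ≤ (m : ℝ) * L ^ 2 := by positivity
      nlinarith
    refine h1.trans_eq ?_
    rw [Real.exp_neg, hexpL, one_div]
  have hy0 : y ≠ 0 := by
    intro hy0
    rw [hy0, sub_zero] at hwy
    linarith
  obtain ⟨f, hfirr, hfdeg, hfdegle, hfroot, hβ0, hfM⟩ := hβ r hr0
  refine ⟨q, hmq, f, specY G D r.num r.den, y, βof r, hfirr, hfdeg, hS0, hfroot, hy, hy0, hβ0,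
    by rw [hSdeg]; exact Nat.mul_le_mul_left K hfdegle, ?_, ?_, ?_⟩
  · -- `log M(S) ≤ c log q`
    have hMS := mahlerMeasure_specY_le G hD p q (by rw [← hp, ← hq] at hSdeg; exact hSdeg.le)
    have hMS1 := one_le_mahlerMeasure_int hS0
    have hRL0 : 0 < relLen G := by linarith
    have hK1 : (0 : ℝ) < (K : ℝ) + 1 := by linarith [(Nat.cast_nonneg K : (0 : ℝ) ≤ K)]
    calc Real.log ((specY G D r.num r.den).map (Int.castRingHom ℂ)).mahlerMeasure
        ≤ Real.log (((K : ℝ) + 1) * (relLen G * ((|p| : ℝ) + q) ^ D)) :=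
          Real.log_le_log (by linarith) hMS
      _ = Real.log ((K : ℝ) + 1) + Real.log (relLen G) + D * Real.log ((|p| : ℝ) + q) := by
          rw [Real.log_mul hK1.ne' (by positivity), Real.log_mul hRL0.ne' (by positivity),
            Real.log_pow]; ring
      _ ≤ Real.log ((K : ℝ) + 1) * L + Real.log (relLen G) * L + D * (A * L) := by
          gcongr ?_ + ?_ + ?_
          · exact le_mul_of_one_le_right hlK0 hL1
          · exact le_mul_of_one_le_right hlR0 hL1
          · exact mul_le_mul_of_nonneg_left hlogpq' (Nat.cast_nonneg D)
      _ ≤ c * L := by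
          have h0 : 0 ≤ A * L := by positivity
          have h0' : 0 ≤ Cβ * (A * L) := mul_nonneg hCβ h0
          have e : c * L = Real.log ((K : ℝ) + 1) * L + Real.log (relLen G) * L + D * (A * L) +
              A * L + Cβ * (A * L) := by
            rw [hc]; ring
          rw [e]; linarith
  · -- `log M(f) ≤ c log q`
    calc Real.log ((f.map (Int.castRingHom ℂ)).mahlerMeasure)
        ≤ Cβ * Real.log ((|p| : ℝ) + q) := by rw [hp, hq]; exact hfM
      _ ≤ Cβ * (A * L) := mul_le_mul_of_nonneg_left hlogpq' hCβ
      _ = (Cβ * A) * L := by ring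
      _ ≤ c * L := mul_le_mul_of_nonneg_right hAc hL0
  · -- the distance
    rw [hdist r, hwu]
    calc ‖w - y‖ + |ℓ - ↑r| < ε / 2 + ε / 2 := add_lt_add hwy hℓr
      _ = ε := by ring
      _ ≤ Real.exp (-((m : ℝ) * Real.log q ^ 2)) := by
          rw [hε, Real.exp_le_exp, neg_le_neg_iff, ← hL]
          nlinarith [sq_nonneg L]

/-- **P2 (the real instance): `ℓ` log-square Liouville and `ℓ, e^ℓ` dependent ⇒ log-square
simultaneous approximations of `(ℓ, e^ℓ)`** (`u = ℓ`, `β_r = r = p/q`, `f = qX − p`, `d_β = 1`). -/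
theorem logSqPairApprox_of_dependent {ℓ : ℝ} (hℓ : LogSqLiouville ℓ)
    (hdep : ¬ AlgebraicIndependent ℚ ![(ℓ : ℂ), cexp ℓ]) : LogSqPairApprox (ℓ : ℂ) := by
  refine logSqPairApprox_of_dependent_gen hℓ rfl hdep (dβ := 1) (fun r => ((r : ℝ) : ℂ)) 2
    (by norm_num) ?_ ?_
  · intro r hr0
    obtain ⟨hfdeg, hfroot, hfM⟩ := linear_poly_facts r
    refine ⟨C (r.den : ℤ) * X + C (-r.num), irreducible_den_mul_X_sub_num' r,
      by rw [hfdeg]; exact one_pos, hfdeg.le, hfroot,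
      Complex.ofReal_ne_zero.mpr (by exact_mod_cast hr0), ?_⟩
    rw [hfM]
    have hq0 : (0 : ℝ) < r.den := by exact_mod_cast r.den_pos
    have hq1 : (1 : ℝ) ≤ r.den := by exact_mod_cast r.den_pos
    have h0 : (0 : ℝ) ≤ |(r.num : ℝ)| := abs_nonneg _
    have h1 : Real.log (max (|(r.num : ℝ)|) (r.den : ℝ)) ≤ Real.log ((|r.num| : ℝ) + r.den) :=
      Real.log_le_log (lt_max_of_lt_right hq0) (max_le (by linarith) (by linarith))
    have h2 : 0 ≤ Real.log ((|r.num| : ℝ) + r.den) := Real.log_nonneg (by linarith)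
    linarith
  · intro r
    rw [← Complex.ofReal_sub, Complex.norm_real, Real.norm_eq_abs]

/-- **P3 — FLAGSHIP (mod NW 1996 Thm 1): for every log-square Liouville real `ℓ`, the numbers
`ℓ` and `e^ℓ` are algebraically independent over `ℚ`.**  Round 4 / round 9 had this for
hyper-Liouville `ℓ` (every exponential order) resp. exponential order `k ≥ 49`; the log-square
class is the complement of the product-form wall at bounded degree (read at `E = e`; the
`E`-optimised wall is one `log log q` factor lower, see the module docstring). -/
theorem algebraicIndependent_exp_of_logSqLiouville (hNW : NesterenkoWaldschmidt1996_thm_1) {ℓ : ℝ}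
    (hℓ : LogSqLiouville ℓ) : AlgebraicIndependent ℚ ![(ℓ : ℂ), cexp ℓ] := by
  by_contra hdep
  exact not_logSqPairApprox_of_NW hNW (Complex.ofReal_ne_zero.mpr hℓ.ne_zero)
    (logSqPairApprox_of_dependent hℓ hdep)

end Summit.Schanuel.Schanuel.Theorems.RootDecomp1KGeneric
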